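import Mathlib
import HarnessLib
import Literature.Analysis.FluidPDE.LocalTypeIBlowup.SingularVertexZoom
import Summits.NavierStokesRegularity.NavierStokesRegularity.Theorems.TypeIQuarterGateScarEnvelopeTypeITwinCompactness

/-!
# Line `scar_zoom` on crux `TypeIQuarterGate.ScarEnvelopeTypeI` (stmt-NavierStokesRegularity-23843) —
# tools for STUB B `stub_scarZoom`, file 3: the zoom at a prescribed singular vertex with prescribed
# scales AND a satellite blow-up sequence — a Type-I ancient mild limit with TWO singular points

Helper file (no new definitions).  `exists_typeIAncientMild_twinZoomLimit` is the tree's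
`LocalTypeIBlowup.exists_typeIAncientMild_zoomLimit` (Barker–Prange 2020, §4 Steps 2–3 with
Lemma 3; Seregin–Šverák 2009, Thm. 2.8; Albritton–Barker 2019, Prop. 2.3: the zoom of a local
suitable weak solution with the Type-I RATE at a backward singular vertex `z₀` along ANY scales
`R_n → 0` subconverges to a field of the class `IsTypeIAncientMild M` which is a suitable weak
solution on the backward slab with `𝐈 < ∞` and a singular ORIGIN) with ONE more input and ONE more
output.  Input: a SATELLITE blow-up sequence — zoomed points `(s_n, η_n) → (0⁻, e)` at which the
zooms blow up, `R_n ‖u(z₀.1 + R_n² s_n, z₀.2 + R_n η_n)‖ → ∞`.  Output: the limit is ALSO singular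
at `(0, e)` — by the engine of file 2 (`local_typeI_compactness_twin`: persistence at every
blow-up point of the closed slab), the `L^∞(Q((0,e), r))` blow-up along the extracted subsequence
being read off the values at the satellite points (the zooms are continuous there).  Steps 1–5 are
the tree's, verbatim; the `C¹_loc` convergence export of the tree's theorem is dropped (not needed
by STUB B).

Bookkeeping only; no statement about the crux, its parent or the summit is proved here.
-/

noncomputable section

-- the summit-side namespace `Summit.NavierStokesRegularity.NavierStokesRegularity.…` (single-conjunct
-- summit, D-0017) repeats a component by design; the dupNamespace linter would flag every declaration.
set_option linter.dupNamespace false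

namespace Summit.NavierStokesRegularity.NavierStokesRegularity.Cruxes.ScarEnvelopeTypeI.ScarZoom

open MeasureTheory Set Function Filter Topology TopologicalSpace Metric
open scoped NNReal ENNReal
open Literature.Analysis Literature.Analysis.FluidPDE Literature.Analysis.FluidPDE.LocalTypeIBlowup

/-! ### Two small tools -/

/-- **A function continuous on an open set is bounded there by its essential supremum** (Lebesgue
measure charges nonempty open sets): `‖h x‖ₑ ≤ ‖h‖_{L^∞(O)}` for `x ∈ O`. -/
private theorem enorm_le_eLpNorm_top_of_continuousOn' {O : Set (ℝ × (EuclideanSpace ℝ (Fin 3)))}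
    (hO : IsOpen O) {h : ℝ × (EuclideanSpace ℝ (Fin 3)) → EuclideanSpace ℝ (Fin 3)}
    (hh : ContinuousOn h O) {x : ℝ × (EuclideanSpace ℝ (Fin 3))} (hx : x ∈ O) :
    ‖h x‖ₑ ≤ eLpNorm h ∞ (volume.restrict O) := by
  by_contra hlt
  push Not at hlt
  set S : ℝ≥0∞ := eLpNorm h ∞ (volume.restrict O) with hS
  have hae : ∀ᵐ y ∂(volume.restrict O), ‖h y‖ₑ ≤ S := by
    rw [hS, eLpNorm_exponent_top]
    exact enorm_ae_le_eLpNormEssSup h _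
  set W : Set (ℝ × (EuclideanSpace ℝ (Fin 3))) := O ∩ (fun y => ‖h y‖ₑ) ⁻¹' Ioi S with hW_def
  have hW : IsOpen W := (continuous_enorm.comp_continuousOn hh).isOpen_inter_preimage hO isOpen_Ioi
  have hxW : x ∈ W := ⟨hx, hlt⟩
  have hpos : 0 < volume W := hW.measure_pos volume ⟨x, hxW⟩
  have hzero : volume.restrict O W = 0 := by
    refine measure_mono_null (fun y hy => ?_) (ae_iff.1 hae)
    exact not_le.2 hy.2
  rw [Measure.restrict_apply hW.measurableSet, inter_eq_left.2 inter_subset_left] at hzero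
  exact hpos.ne' hzero

/-- Every point of the open backward slab lies in some `Q(0, 2ᵐ)`. -/
private theorem exists_mem_parabolicCylinder_two_pow {t : ℝ} (ht : t < 0) (x : EuclideanSpace ℝ (Fin 3)) :
    ∃ m : ℕ, ((t, x) : ℝ × (EuclideanSpace ℝ (Fin 3))) ∈
      parabolicCylinder ((2 : ℝ) ^ m) (0 : ℝ × (EuclideanSpace ℝ (Fin 3))) := by
  obtain ⟨m, hm⟩ := pow_unbounded_of_one_lt (max (-t) ‖x‖ + 1) (by norm_num : (1 : ℝ) < 2)
  refine ⟨m, ?_⟩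
  have h1 : (1 : ℝ) ≤ (2 : ℝ) ^ m := one_le_pow₀ (by norm_num)
  have h2 : -t < (2 : ℝ) ^ m := by linarith [le_max_left (-t) ‖x‖]
  have h3 : ‖x‖ < (2 : ℝ) ^ m := by linarith [le_max_right (-t) ‖x‖]
  rw [mem_parabolicCylinder]
  simp only [Prod.fst_zero, Prod.snd_zero, zero_sub, dist_zero_right]
  refine ⟨⟨?_, ht⟩, h3⟩
  nlinarith

/-- Strong `L³` convergence on a set has an a.e. convergent subsequence. -/
private theorem exists_subseq_tendsto_ae' {Q₀ : Set (ℝ × (EuclideanSpace ℝ (Fin 3)))}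
    {v : ℕ → ℝ → (EuclideanSpace ℝ (Fin 3)) → (EuclideanSpace ℝ (Fin 3))}
    {U : ℝ → (EuclideanSpace ℝ (Fin 3)) → (EuclideanSpace ℝ (Fin 3))}
    (hv : ∀ k, AEStronglyMeasurable (uncurry (v k)) (volume.restrict Q₀))
    (hU : AEStronglyMeasurable (uncurry U) (volume.restrict Q₀))
    (hconv : Tendsto (fun k => eLpNorm (uncurry (v k) - uncurry U) 3 (volume.restrict Q₀))
      atTop (𝓝 0)) :
    ∃ φ : ℕ → ℕ, StrictMono φ ∧ ∀ᵐ w ∂(volume.restrict Q₀),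
      Tendsto (fun i => uncurry (v (φ i)) w) atTop (𝓝 (uncurry U w)) :=
  (tendstoInMeasure_of_tendsto_eLpNorm (by norm_num) hv hU hconv).exists_seq_tendsto_ae

/-! ### The twin zoom -/

/-- **The zoom at a prescribed backward singular vertex with prescribed scales and a satellite
blow-up sequence** (Barker–Prange 2020 §4 Steps 2–3 + Lemma 3; Seregin–Šverák 2009 Thm 2.8;
Albritton–Barker 2019 Prop. 2.3, at two points).  Let `(u, p)` be a suitable weak solution in
`Q(z₀, ρ)` (Albritton–Barker's class) with a weak gradient `G`, `𝐈(Q(z₀, ρ)) < ∞`, `u` continuous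
on `Q(z₀, ρ)` with the Type-I RATE `‖u(t,x)‖ ≤ M/√(z₀.1 − t)`, and `z₀` a backward singular
point.  Let `R_n > 0`, `R_n → 0`, and let `(s_n, η_n)` be zoomed points with `s_n < 0`, `s_n → 0`,
`η_n → e` and `R_n ‖u(z₀.1 + R_n² s_n, z₀.2 + R_n η_n)‖ → ∞`.  Then there is a field `U` of the
class `IsTypeIAncientMild M U` which, with a pressure and a weak gradient, is a suitable weak
solution on the backward slab with `𝐈 < ∞`, and which has backward singular points at the origin
AND at `(0, e)`. -/
theorem exists_typeIAncientMild_twinZoomLimit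
    {u : ℝ → (EuclideanSpace ℝ (Fin 3)) → (EuclideanSpace ℝ (Fin 3))}
    {p : ℝ → (EuclideanSpace ℝ (Fin 3)) → ℝ}
    {G : ℝ → (EuclideanSpace ℝ (Fin 3)) → (EuclideanSpace ℝ (Fin 3)) →L[ℝ] (EuclideanSpace ℝ (Fin 3))}
    {z₀ : ℝ × (EuclideanSpace ℝ (Fin 3))} {ρ M : ℝ} (hρ : 0 < ρ)
    (hball : IsSuitableWeakSolutionInBall ρ z₀ u p)
    (hwg : HasWeakSpatialGradientOn (parabolicCylinderOpens ρ z₀) u G)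
    (hI : typeIBound (parabolicCylinder ρ z₀) u p G < ⊤)
    (hcont : ContinuousOn (uncurry u) (parabolicCylinder ρ z₀))
    (hrate : ∀ (t : ℝ) (x : EuclideanSpace ℝ (Fin 3)), (t, x) ∈ parabolicCylinder ρ z₀ →
      ‖u t x‖ ≤ M / Real.sqrt (z₀.1 - t))
    (hsing : IsBackwardSingularPoint u z₀)
    {R : ℕ → ℝ} (hR : ∀ n, 0 < R n) (hR0 : Tendsto R atTop (𝓝 0))
    {s : ℕ → ℝ} {η : ℕ → EuclideanSpace ℝ (Fin 3)} {e : EuclideanSpace ℝ (Fin 3)}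
    (hs : ∀ n, s n < 0) (hs0 : Tendsto s atTop (𝓝 0)) (hη : Tendsto η atTop (𝓝 e))
    (hsat : Tendsto (fun n => R n * ‖u (z₀.1 + R n ^ 2 * s n) (z₀.2 + R n • η n)‖) atTop atTop) :
    ∃ (U : ℝ → (EuclideanSpace ℝ (Fin 3)) → (EuclideanSpace ℝ (Fin 3)))
      (P : ℝ → (EuclideanSpace ℝ (Fin 3)) → ℝ)
      (H : ℝ → (EuclideanSpace ℝ (Fin 3)) → (EuclideanSpace ℝ (Fin 3)) →L[ℝ] (EuclideanSpace ℝ (Fin 3))),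
      IsTypeIAncientMild M U ∧
      IsSuitableWeakSolutionOn (slab (EuclideanSpace ℝ (Fin 3)) (Iio 0) isOpen_Iio) 1 0 U P ∧
      HasWeakSpatialGradientOn (slab (EuclideanSpace ℝ (Fin 3)) (Iio 0) isOpen_Iio) U H ∧
      typeIBound (Iio (0 : ℝ) ×ˢ univ) U P H < ⊤ ∧
      IsBackwardSingularPoint U 0 ∧
      IsBackwardSingularPoint U ((0 : ℝ), e) := by
  -- ## constants
  have hρ2 : 0 < ρ ^ 2 := pow_pos hρ 2
  have hM : 0 ≤ M := by
    have hmem : ((z₀.1 - ρ ^ 2 / 2, z₀.2) : ℝ × (EuclideanSpace ℝ (Fin 3))) ∈ parabolicCylinder ρ z₀ := by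
      rw [mem_parabolicCylinder]
      exact ⟨⟨by linarith, by linarith⟩, by simp [hρ]⟩
    have h := hrate _ _ hmem
    have hs : 0 < Real.sqrt (z₀.1 - (z₀.1 - ρ ^ 2 / 2)) := Real.sqrt_pos.2 (by linarith)
    by_contra hM
    push Not at hM
    linarith [norm_nonneg (u (z₀.1 - ρ ^ 2 / 2) z₀.2), div_neg_of_neg_of_pos hM hs]
  have hcc_pos : ∀ m : ℕ, (0 : ℝ) < (2 : ℝ) ^ m := fun m => by positivity
  set I : ℝ≥0∞ := typeIBound (parabolicCylinder ρ z₀) u p G with hIdef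
  -- ## Step 1: fast scales `lam k = R (φ₀ k) ≤ ρ / 2^(k+2)`
  have hev : ∀ k : ℕ, ∀ᶠ n in atTop, R n ≤ ρ / (2 : ℝ) ^ (k + 2) := fun k =>
    (hR0.eventually (Iic_mem_nhds (by positivity : (0 : ℝ) < ρ / (2 : ℝ) ^ (k + 2)))).mono
      fun n hn => hn
  obtain ⟨φ₀, hφ₀, hφ₀R⟩ := extraction_forall_of_eventually hev
  set lam : ℕ → ℝ := fun k => R (φ₀ k) with hlam
  have hlam0 : ∀ k, 0 < lam k := fun k => hR (φ₀ k)
  have hbig : ∀ k, (2 : ℝ) ^ (k + 2) ≤ ρ / lam k := fun k => by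
    rw [le_div_iff₀ (hlam0 k)]
    have h := hφ₀R k
    rw [le_div_iff₀ (hcc_pos (k + 2))] at h
    simpa only [hlam, mul_comm] using h
  -- ## Step 2: the zoomed pairs and their properties
  set v : ℕ → ℝ → (EuclideanSpace ℝ (Fin 3)) → (EuclideanSpace ℝ (Fin 3)) :=
    fun k => lam k • stPull (lam k ^ 2) (lam k) z₀.1 z₀.2 u with hv
  set qz : ℕ → ℝ → (EuclideanSpace ℝ (Fin 3)) → ℝ :=
    fun k => lam k ^ 2 • stPull (lam k ^ 2) (lam k) z₀.1 z₀.2 p with hqz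
  set Gz : ℕ → ℝ → (EuclideanSpace ℝ (Fin 3)) → (EuclideanSpace ℝ (Fin 3)) →L[ℝ] (EuclideanSpace ℝ (Fin 3)) :=
    fun k => lam k ^ 2 • stPull (lam k ^ 2) (lam k) z₀.1 z₀.2 G with hGz
  -- the class on `Q(0, ρ / lam k)`
  have hInbig : ∀ k, IsSuitableWeakSolutionInBall (ρ / lam k) 0 (v k) (qz k) := by
    intro k
    have h1 := hball.zoom hρ
    set c : ℝ := lam k / ρ with hc
    have hc0 : 0 < c := div_pos (hlam0 k) hρ
    have h2 := h1.zoomOut hc0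
    have hcρ : c * ρ = lam k := div_mul_cancel₀ _ hρ.ne'
    have hrad : 1 / c = ρ / lam k := by rw [hc, one_div_div]
    rw [zoom_zoom, zoom_zoom, hcρ, hrad, show c ^ 2 * ρ ^ 2 = lam k ^ 2 by rw [← hcρ]; ring] at h2
    exact h2
  have hsub : ∀ m k : ℕ, m ≤ k + 2 →
      parabolicCylinder ((2 : ℝ) ^ m) (0 : ℝ × (EuclideanSpace ℝ (Fin 3))) ⊆
        parabolicCylinder (ρ / lam k) (0 : ℝ × (EuclideanSpace ℝ (Fin 3))) := fun m k hmk =>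
    parabolicCylinder_mono (hcc_pos m).le ((pow_le_pow_right₀ (by norm_num) hmk).trans (hbig k)) _
  have hballs : ∀ m k : ℕ, m ≤ k + 2 →
      IsSuitableWeakSolutionInBall ((2 : ℝ) ^ m) 0 (v k) (qz k) := fun m k hmk =>
    (hInbig k).of_subset_zero (hcc_pos m) (hsub m k hmk)
  -- the weak gradients
  have hpre : ∀ k, stPreimage (lam k ^ 2) (lam k) z₀.1 z₀.2 (parabolicCylinderOpens ρ z₀) =
      parabolicCylinderOpens (ρ / lam k) (0 : ℝ × (EuclideanSpace ℝ (Fin 3))) := fun k =>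
    Opens.ext (zoom_preimage_parabolicCylinder (hlam0 k) z₀ ρ)
  have hgrads : ∀ m k : ℕ, m ≤ k + 2 →
      HasWeakSpatialGradientOn (parabolicCylinderOpens ((2 : ℝ) ^ m) (0 : ℝ × (EuclideanSpace ℝ (Fin 3))))
        (v k) (Gz k) := by
    intro m k hmk
    have h1 := hwg.stRescale (lam k) (β := lam k ^ 2) (γ := lam k) (pow_pos (hlam0 k) 2) (hlam0 k)
      z₀.1 z₀.2
    rw [show lam k * lam k = lam k ^ 2 by ring, hpre k] at h1
    exact h1.mono (fun w hw => hsub m k hmk hw)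
  -- the Type I bound
  have hIs : ∀ m k : ℕ, m ≤ k + 2 →
      typeIBound (parabolicCylinder ((2 : ℝ) ^ m) (0 : ℝ × (EuclideanSpace ℝ (Fin 3)))) (v k) (qz k) (Gz k) ≤ I := by
    intro m k hmk
    rw [hIdef, ← typeIBound_nsZoom (hlam0 k) z₀.1 z₀.2 (parabolicCylinder ρ z₀) u p G,
      zoom_preimage_parabolicCylinder (hlam0 k) z₀ ρ]
    exact typeIBound_mono (hsub m k hmk)
  -- blow-up on every `Q(0, r)`: the vertex `z₀` is singular
  have hst0 : ∀ k, stAffine (lam k ^ 2) (lam k) z₀.1 z₀.2 (0 : ℝ × (EuclideanSpace ℝ (Fin 3))) = z₀ := by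
    intro k
    rw [show (0 : ℝ × (EuclideanSpace ℝ (Fin 3))) = ((0 : ℝ), (0 : EuclideanSpace ℝ (Fin 3))) from rfl,
      stAffine_apply, mul_zero, add_zero, smul_zero, add_zero]
  have hblow : ∀ k (r : ℝ), 0 < r →
      eLpNorm (uncurry (v k)) ⊤ (volume.restrict (parabolicCylinder r (0 : ℝ × (EuclideanSpace ℝ (Fin 3))))) = ⊤ := by
    intro k r hr
    show eLpNorm (uncurry (lam k • stPull (lam k ^ 2) (lam k) z₀.1 z₀.2 u)) ⊤ _ = ⊤
    rw [eLpNorm_top_nsZoom (hlam0 k) z₀.1 z₀.2 r 0 u, hst0, hsing (lam k * r) (mul_pos (hlam0 k) hr),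
      ENNReal.mul_top (ENNReal.ofReal_pos.2 (hlam0 k)).ne']
  -- the rate on `Q(0, ρ / lam k)`
  have hratev : ∀ k, ∀ w ∈ parabolicCylinder (ρ / lam k) (0 : ℝ × (EuclideanSpace ℝ (Fin 3))),
      ‖v k w.1 w.2‖ ≤ M / Real.sqrt (-w.1) := by
    rintro k ⟨s, y⟩ hw
    have hmem := zoom_mem_parabolicCylinder (hlam0 k) z₀ hw
    rw [stAffine_apply] at hmem
    have hs0 : s < 0 := by
      rw [mem_parabolicCylinder] at hw
      simpa using hw.1.2
    have h := hrate _ _ hmem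
    have hsq : Real.sqrt (z₀.1 - (z₀.1 + lam k ^ 2 * s)) = lam k * Real.sqrt (-s) := by
      rw [show z₀.1 - (z₀.1 + lam k ^ 2 * s) = lam k ^ 2 * (-s) by ring, Real.sqrt_mul (sq_nonneg _),
        Real.sqrt_sq (hlam0 k).le]
    rw [hsq] at h
    have hspos : 0 < Real.sqrt (-s) := Real.sqrt_pos.2 (by linarith)
    show ‖(lam k • stPull (lam k ^ 2) (lam k) z₀.1 z₀.2 u) s y‖ ≤ M / Real.sqrt (-s)
    rw [smul_stPull_apply, norm_smul, Real.norm_of_nonneg (hlam0 k).le, le_div_iff₀ hspos]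
    have h' := (le_div_iff₀ (mul_pos (hlam0 k) hspos)).1 h
    calc lam k * ‖u (z₀.1 + lam k ^ 2 * s) (z₀.2 + lam k • y)‖ * Real.sqrt (-s)
        = ‖u (z₀.1 + lam k ^ 2 * s) (z₀.2 + lam k • y)‖ * (lam k * Real.sqrt (-s)) := by ring
      _ ≤ M := h'
  -- continuity of the zooms on `Q(0, ρ / lam k)`
  have hvc : ∀ k, ContinuousOn (uncurry (v k))
      (parabolicCylinder (ρ / lam k) (0 : ℝ × (EuclideanSpace ℝ (Fin 3)))) := by
    intro k
    have e : uncurry (v k) = fun w => lam k • (uncurry u ∘ stAffine (lam k ^ 2) (lam k) z₀.1 z₀.2) w := by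
      funext w
      rfl
    rw [e]
    refine ContinuousOn.const_smul (hcont.comp (continuous_stAffine _ _ _ _).continuousOn ?_) (lam k)
    exact fun w hw => zoom_mem_parabolicCylinder (hlam0 k) z₀ hw
  -- ## Step 3: compactness with persistence of the singularity
  obtain ⟨Ut, Pt, Ht, σ, hσ, hswU, hHU, h4I, hmemU, hconvU, hpers⟩ :=
    local_typeI_compactness_twin I v qz Gz hI (fun m k hmk => hballs m k (by omega))
      (fun m k hmk => hgrads m k (by omega)) (fun m k hmk => hIs m k (by omega))
  have hσge : ∀ j, j ≤ σ j := fun j => hσ.id_le j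
  have hsingU : IsBackwardSingularPoint Ut 0 := hpers 0 le_rfl fun r hr => by
    simp only [hblow _ r hr.1]
    exact limsup_const ⊤
  -- ## Step 3b: persistence at the satellite point `(0, e)`
  have hsatU : IsBackwardSingularPoint Ut ((0 : ℝ), e) := by
    refine hpers ((0 : ℝ), e) le_rfl fun r hr => ?_
    -- a level `m` with `Q((0,e), r) ⊆ Q(0, 2^m)`
    obtain ⟨m, hm⟩ := pow_unbounded_of_one_lt (‖e‖ + 2) (by norm_num : (1 : ℝ) < 2)
    have hm1 : (1 : ℝ) ≤ (2 : ℝ) ^ m := one_le_pow₀ (by norm_num)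
    have hQe : parabolicCylinder r (((0 : ℝ), e) : ℝ × (EuclideanSpace ℝ (Fin 3))) ⊆
        parabolicCylinder ((2 : ℝ) ^ m) (0 : ℝ × (EuclideanSpace ℝ (Fin 3))) := by
      intro w hw
      rw [mem_parabolicCylinder] at hw ⊢
      simp only [Prod.fst_zero, Prod.snd_zero, zero_sub, dist_zero_right] at hw ⊢
      obtain ⟨⟨h1, h2⟩, h3⟩ := hw
      have hr2 : r ^ 2 < 1 := by nlinarith [hr.1, hr.2]
      refine ⟨⟨by nlinarith, h2⟩, ?_⟩
      calc ‖w.2‖ = ‖(w.2 - e) + e‖ := by rw [sub_add_cancel]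
        _ ≤ ‖w.2 - e‖ + ‖e‖ := norm_add_le _ _
        _ < r + ‖e‖ := by rw [← dist_eq_norm]; linarith [h3]
        _ ≤ (2 : ℝ) ^ m := by linarith [hr.2]
    -- the satellite points along `φ₀ ∘ σ` and the values there
    set pt : ℕ → ℝ × (EuclideanSpace ℝ (Fin 3)) := fun j => (s (φ₀ (σ j)), η (φ₀ (σ j))) with hpt
    have hψ : Tendsto (fun j => φ₀ (σ j)) atTop atTop := hφ₀.tendsto_atTop.comp hσ.tendsto_atTop
    have hval : ∀ j, ‖v (σ j) (pt j).1 (pt j).2‖ =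
        R (φ₀ (σ j)) * ‖u (z₀.1 + R (φ₀ (σ j)) ^ 2 * s (φ₀ (σ j))) (z₀.2 + R (φ₀ (σ j)) • η (φ₀ (σ j)))‖ := by
      intro j
      show ‖(lam (σ j) • stPull (lam (σ j) ^ 2) (lam (σ j)) z₀.1 z₀.2 u) (s (φ₀ (σ j))) (η (φ₀ (σ j)))‖ = _
      rw [smul_stPull_apply, norm_smul, Real.norm_of_nonneg (hlam0 (σ j)).le]
    have htop : Tendsto (fun j => (‖v (σ j) (pt j).1 (pt j).2‖ₑ : ℝ≥0∞)) atTop (𝓝 ⊤) := by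
      have h1 : Tendsto (fun j => ‖v (σ j) (pt j).1 (pt j).2‖) atTop atTop := by
        simp only [hval]
        exact hsat.comp hψ
      have h2 := ENNReal.tendsto_ofReal_atTop.comp h1
      refine (tendsto_congr fun j => ?_).1 h2
      simp only [comp_apply, ofReal_norm]
    -- eventually the satellite point lies in `Q((0,e), r)` and the zoom is continuous there
    have hev_mem : ∀ᶠ j in atTop, pt j ∈ parabolicCylinder r (((0 : ℝ), e) : ℝ × (EuclideanSpace ℝ (Fin 3))) := by
      have h1 : ∀ᶠ j in atTop, -r ^ 2 < s (φ₀ (σ j)) :=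
        (hs0.comp hψ).eventually (lt_mem_nhds (by nlinarith [hr.1] : -r ^ 2 < (0 : ℝ)))
      have h2 : ∀ᶠ j in atTop, η (φ₀ (σ j)) ∈ ball e r := (hη.comp hψ).eventually_mem (ball_mem_nhds e hr.1)
      filter_upwards [h1, h2] with j hj1 hj2
      rw [mem_parabolicCylinder]
      exact ⟨⟨by simpa using hj1, by simpa using hs (φ₀ (σ j))⟩, hj2⟩
    have hev_ge : ∀ᶠ j in atTop, (‖v (σ j) (pt j).1 (pt j).2‖ₑ : ℝ≥0∞) ≤
        eLpNorm (uncurry (v (σ j))) ⊤ (volume.restrict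
          (parabolicCylinder r (((0 : ℝ), e) : ℝ × (EuclideanSpace ℝ (Fin 3))))) := by
      filter_upwards [hev_mem, eventually_ge_atTop m] with j hjmem hjm
      have hsubj : parabolicCylinder r (((0 : ℝ), e) : ℝ × (EuclideanSpace ℝ (Fin 3))) ⊆
          parabolicCylinder (ρ / lam (σ j)) (0 : ℝ × (EuclideanSpace ℝ (Fin 3))) :=
        hQe.trans (hsub m (σ j) (by linarith [hσge j]))
      exact enorm_le_eLpNorm_top_of_continuousOn' (isOpen_parabolicCylinder _ _)
        ((hvc (σ j)).mono hsubj) hjmem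
    have hlim_inf : liminf (fun j => (‖v (σ j) (pt j).1 (pt j).2‖ₑ : ℝ≥0∞)) atTop = ⊤ := htop.liminf_eq
    refine eq_top_iff.2 ?_
    calc (⊤ : ℝ≥0∞) = liminf (fun j => (‖v (σ j) (pt j).1 (pt j).2‖ₑ : ℝ≥0∞)) atTop := hlim_inf.symm
      _ ≤ liminf (fun j => eLpNorm (uncurry (v (σ j))) ⊤ (volume.restrict
          (parabolicCylinder r (((0 : ℝ), e) : ℝ × (EuclideanSpace ℝ (Fin 3)))))) atTop :=
        liminf_le_liminf hev_ge
      _ ≤ limsup (fun j => eLpNorm (uncurry (v (σ j))) ⊤ (volume.restrict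
          (parabolicCylinder r (((0 : ℝ), e) : ℝ × (EuclideanSpace ℝ (Fin 3)))))) atTop :=
        liminf_le_limsup
  have h4Itop : typeIBound (Iio (0 : ℝ) ×ˢ univ) Ut Pt Ht < ⊤ :=
    lt_of_le_of_lt h4I (ENNReal.mul_lt_top (by simp) hI)
  -- ## Step 4: the rate, almost everywhere on the slab
  have hrate_ae : ∀ᵐ w ∂(volume.restrict (Iio (0 : ℝ) ×ˢ (univ : Set (EuclideanSpace ℝ (Fin 3))))),
      ‖Ut w.1 w.2‖ ≤ M / Real.sqrt (-w.1) := by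
    have hQ : ∀ m : ℕ, ∀ᵐ w ∂(volume.restrict (parabolicCylinder ((2 : ℝ) ^ m) (0 : ℝ × (EuclideanSpace ℝ (Fin 3))))),
        ‖Ut w.1 w.2‖ ≤ M / Real.sqrt (-w.1) := by
      intro m
      have hmeas : ∀ j, AEStronglyMeasurable (uncurry (v (σ (j + m))))
          (volume.restrict (parabolicCylinder ((2 : ℝ) ^ m) (0 : ℝ × (EuclideanSpace ℝ (Fin 3))))) := fun j =>
        (hballs m (σ (j + m)) (by linarith [hσge (j + m)])).1.distributional.1.aestronglyMeasurable
      obtain ⟨ψ₁, hψ₁, hae⟩ := exists_subseq_tendsto_ae' hmeas (hmemU _ (hcc_pos m)).1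
        ((hconvU _ (hcc_pos m)).comp (tendsto_add_atTop_nat m))
      filter_upwards [hae, ae_restrict_mem (isOpen_parabolicCylinder _ _).measurableSet] with w hw hwmem
      refine le_of_tendsto hw.norm (Eventually.of_forall fun i => ?_)
      have hle : m ≤ σ (ψ₁ i + m) + 2 := by linarith [hσge (ψ₁ i + m)]
      exact hratev _ w (hsub m _ hle hwmem)
    have hcover : (Iio (0 : ℝ) ×ˢ (univ : Set (EuclideanSpace ℝ (Fin 3)))) ⊆
        ⋃ m : ℕ, parabolicCylinder ((2 : ℝ) ^ m) (0 : ℝ × (EuclideanSpace ℝ (Fin 3))) := by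
      rintro ⟨t, x⟩ ⟨ht, -⟩
      obtain ⟨m, hm⟩ := exists_mem_parabolicCylinder_two_pow (mem_Iio.1 ht) x
      exact mem_iUnion.2 ⟨m, hm⟩
    exact ae_restrict_of_ae_restrict_of_subset hcover ((ae_restrict_iUnion_iff _ _).2 hQ)
  -- ## Step 5: the representatives (rate everywhere; continuous Oseen-mild)
  obtain ⟨U₁, hae₁, hsw₁, hwg₁, hI₁, hdec₁, hsing₁⟩ :=
    exists_rate_profile_repr hM hswU hHU h4Itop hsingU hrate_ae
  obtain ⟨U, hae₂, hUc, hUdiv, hUmild, hUrate⟩ := exists_oseenMild_repr_of_typeIBound_lt_top hsw₁ hdec₁ hI₁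
  have hae₂' : ∀ᵐ w ∂(volume.restrict ((slab (EuclideanSpace ℝ (Fin 3)) (Iio 0) isOpen_Iio :
      Opens (ℝ × (EuclideanSpace ℝ (Fin 3)))) : Set (ℝ × (EuclideanSpace ℝ (Fin 3))))),
      uncurry U₁ w = uncurry U w := by
    rw [coe_slab]
    exact hae₂
  have hswU' : IsSuitableWeakSolutionOn (slab (EuclideanSpace ℝ (Fin 3)) (Iio 0) isOpen_Iio) 1 0 U Pt :=
    hsw₁.congr_ae hae₂' (ae_of_all _ fun _ => rfl)
  have hwgU' : HasWeakSpatialGradientOn (slab (EuclideanSpace ℝ (Fin 3)) (Iio 0) isOpen_Iio) U Ht :=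
    hwg₁.congr_ae hae₂'
  have hIU' : typeIBound (Iio (0 : ℝ) ×ˢ univ) U Pt Ht < ⊤ := by
    rwa [← typeIBound_congr_ae hae₂]
  have hsingU' : IsBackwardSingularPoint U 0 :=
    hsing₁.congr_ae (fun r _ => parabolicCylinder_origin_subset_slab r) hae₂
  have hTI : IsTypeIAncientMild M U := isTypeIAncientMild_of_continuous_oseenMild_rate hUc hUdiv hUmild hUrate
  have haeU : ∀ᵐ w ∂(volume.restrict (Iio (0 : ℝ) ×ˢ (univ : Set (EuclideanSpace ℝ (Fin 3))))),
      uncurry Ut w = uncurry U w := by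
    filter_upwards [hae₁, hae₂] with w h1 h2
    rw [h1, h2]

  -- ## Step 6: the satellite singularity passes to the representatives; conclusion
  have hslab_e : ∀ r : ℝ, 0 < r → parabolicCylinder r (((0 : ℝ), e) : ℝ × (EuclideanSpace ℝ (Fin 3))) ⊆
      Iio (0 : ℝ) ×ˢ (univ : Set (EuclideanSpace ℝ (Fin 3))) := by
    intro r _ w hw
    rw [mem_parabolicCylinder] at hw
    exact ⟨hw.1.2, mem_univ _⟩
  have hsat₁ : IsBackwardSingularPoint U₁ ((0 : ℝ), e) := hsatU.congr_ae hslab_e hae₁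
  have hsatU' : IsBackwardSingularPoint U ((0 : ℝ), e) := hsat₁.congr_ae hslab_e hae₂
  exact ⟨U, Pt, Ht, hTI, hswU', hwgU', hIU', hsingU', hsatU'⟩


end Summit.NavierStokesRegularity.NavierStokesRegularity.Cruxes.ScarEnvelopeTypeI.ScarZoom

end
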